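import Summits.RiemannHypothesis.RiemannHypothesis.Theorems.GroundBartaGroundBartaFloorLeakageEnvelope
import Summits.RiemannHypothesis.RiemannHypothesis.Theorems.GroundBartaGroundBartaFloorLeakageSign
import Summits.RiemannHypothesis.RiemannHypothesis.Theorems.WeilGroundStateGroundStatesConvergeToXiStubStrongClassPairing
import Summits.RiemannHypothesis.RiemannHypothesis.Theorems.WeilGroundStateGroundStatesConvergeToXiStubHarmonicExtension
import Literature.NumberTheory.LFunctions.WeilOddThetaVector
import Mathlib.Analysis.Calculus.IteratedDeriv.Lemmas
import HarnessLib

/-!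
# Crux `GroundBarta.GroundBartaFloor` (stmt-RiemannHypothesis-18389), line `inner-cutoff-strong-EL`:
stubs 2 (`stub_groundPairingClass`) and 4 (`stub_groundPolar`) — the collar pairing `w ⋆ κ̃`

For a non-negative integrable `w` vanishing off the open window `(-a, a)` and a smooth cut-off `θ`
vanishing for `|t| ≥ a` with `0 ≤ θ ≤ 1`, the collar-plus-tail kernel `κ = Φ(1 - θ)` (`Φ` Riemann's
kernel) lies in the strong exponential Weil class (`stub_leakageKernelEnvelope`, landed by prover A:
`θ` has compact support), `w` is weighted-`L¹` for every exponential weight, so the pairing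
`F = w ⋆ κ̃` is smooth with `‖F‖, ‖F'‖, ‖F''‖ ≤ C e^{-|t|}` (`stub_strongClass_pairing`), is the
complexification of the real function `t ↦ ∫ w(s) κ(s - t) ds`, has `‖F'‖ ≤ sup|κ'| · ∫ w`
(`F' = w ⋆ κ̃'`), and — for EVEN `θ` — its polar term is
`ŵ(0) conj κ̂(1) + ŵ(1) conj κ̂(0) = (∫ κ cosh(t/2)) · (∫ w · 2cosh(t/2))` (strip transform formula at
`s = 0, 1`; `κ̂(0) = κ̂(1) = ∫ κ cosh(t/2)` by evenness).  RH-free; Mathlib + proved tree files only.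
-/

set_option linter.dupNamespace false

noncomputable section

open Set MeasureTheory Filter Complex
open scoped Real Topology ComplexConjugate

namespace Summit.RiemannHypothesis.RiemannHypothesis.Theorems.GroundBartaFloor

open Literature.NumberTheory.LFunctions
open Summit.RiemannHypothesis.RiemannHypothesis.Theorems.GroundStatesConvergeToXi

/-! ## Shared data of the collar pairing -/

section Data

variable {a : ℝ} {w θ : ℝ → ℝ}

/-- A cut-off vanishing for `|t| ≥ a` has compact support. -/
theorem ic_hasCompactSupport_cutoff (hθ0 : ∀ t, a ≤ |t| → θ t = 0) : HasCompactSupport θ := by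
  refine HasCompactSupport.of_support_subset_isCompact (isCompact_Icc (a := -a) (b := a))
    fun t ht => ?_
  by_contra h
  apply ht
  apply hθ0
  simp only [mem_Icc, not_and_or, not_le] at h
  rcases h with h | h
  · exact le_of_lt (by linarith [neg_abs_le t])
  · exact le_of_lt (h.trans_le (le_abs_self t))

/-- `w` (integrable, vanishing off `(-a, a)`) is weighted-`L¹` for every exponential weight. -/
theorem ic_integrable_norm_mul_exp (hws : ∀ t, t ∉ Ioo (-a) a → w t = 0) (hwi : Integrable w)
    (b : ℝ) : Integrable (fun t : ℝ => ‖((w t : ℝ) : ℂ)‖ * Real.exp (b * |t|)) := by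
  have hva : AEStronglyMeasurable (fun t => ((w t : ℝ) : ℂ)) volume := hwi.ofReal.aestronglyMeasurable
  refine (hwi.norm.mul_const (Real.exp (|b| * |a|))).mono' (hva.norm.mul (by fun_prop))
    (ae_of_all _ fun t => ?_)
  rw [Real.norm_eq_abs, abs_of_nonneg (by positivity)]
  rw [Complex.norm_real]
  by_cases ht : t ∈ Ioo (-a) a
  · refine mul_le_mul_of_nonneg_left (Real.exp_le_exp.2 ?_) (norm_nonneg _)
    have h1 : |t| ≤ |a| := (abs_lt.2 ⟨ht.1, ht.2⟩).le.trans (le_abs_self a)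
    calc b * |t| ≤ |b| * |t| := mul_le_mul_of_nonneg_right (le_abs_self b) (abs_nonneg t)
      _ ≤ |b| * |a| := mul_le_mul_of_nonneg_left h1 (abs_nonneg b)
  · rw [hws t ht]; simp

/-- The derivative of the complexified kernel is the complexified derivative of the real kernel. -/
theorem ic_deriv_kernel (hθ : ContDiff ℝ (⊤ : ℕ∞) θ) (x : ℝ) :
    deriv (fun t : ℝ => ((weilThetaPhi t * (1 - θ t) : ℝ) : ℂ)) x =
      ((deriv (fun t => weilThetaPhi t * (1 - θ t)) x : ℝ) : ℂ) := by
  have hd : DifferentiableAt ℝ (fun t => weilThetaPhi t * (1 - θ t)) x :=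
    ((differentiable_weilThetaPhi x).mul
      ((differentiableAt_const _).sub (hθ.differentiable (by simp) x)))
  exact (hd.hasDerivAt.ofReal_comp).deriv

end Data

/-! ## Stub 2: the collar pairing lies in the exponential Weil class -/

/-- **Stub 2 of line `inner-cutoff-strong-EL` — the collar pairing lies in the exponential Weil
class.**  For `w ≥ 0` integrable, vanishing off `(-a, a)`, and a smooth cut-off `θ` vanishing for
`|t| ≥ a` with `0 ≤ θ ≤ 1`, the pairing `F = w ⋆ κ̃`, `κ = Φ(1 - θ)`, is smooth with
`‖F‖, ‖F'‖, ‖F''‖ ≤ C e^{-|t|}`, is the real function `t ↦ ∫ w(s) κ(s - t) ds`, and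
`‖F'‖ ≤ sup|κ'| · ∫ w`. -/
theorem stub_groundPairingClass {a : ℝ} {w θ : ℝ → ℝ} (hw : Measurable w) (hw0 : ∀ t, 0 ≤ w t)
    (hws : ∀ t, t ∉ Ioo (-a) a → w t = 0) (hwi : Integrable w) (hθ : ContDiff ℝ (⊤ : ℕ∞) θ)
    (hθ0 : ∀ t, a ≤ |t| → θ t = 0) (hθ01 : ∀ t, 0 ≤ θ t ∧ θ t ≤ 1) :
    ContDiff ℝ (⊤ : ℕ∞) (weilConv (fun t => ((w t : ℝ) : ℂ))
      (weilReflect fun t => ((weilThetaPhi t * (1 - θ t) : ℝ) : ℂ))) ∧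
    (∃ C : ℝ, (∀ t, ‖weilConv (fun t => ((w t : ℝ) : ℂ))
        (weilReflect fun t => ((weilThetaPhi t * (1 - θ t) : ℝ) : ℂ)) t‖ ≤ C * Real.exp (-(1 * |t|))) ∧
      (∀ t, ‖deriv (weilConv (fun t => ((w t : ℝ) : ℂ))
        (weilReflect fun t => ((weilThetaPhi t * (1 - θ t) : ℝ) : ℂ))) t‖ ≤ C * Real.exp (-(1 * |t|))) ∧
      (∀ t, ‖deriv (deriv (weilConv (fun t => ((w t : ℝ) : ℂ))
        (weilReflect fun t => ((weilThetaPhi t * (1 - θ t) : ℝ) : ℂ)))) t‖ ≤ C * Real.exp (-(1 * |t|)))) ∧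
    (∀ t, weilConv (fun t => ((w t : ℝ) : ℂ))
        (weilReflect fun t => ((weilThetaPhi t * (1 - θ t) : ℝ) : ℂ)) t =
      ((∫ s, w s * (weilThetaPhi (s - t) * (1 - θ (s - t))) : ℝ) : ℂ)) ∧
    (∀ B₁ : ℝ, (∀ t, |deriv (fun t => weilThetaPhi t * (1 - θ t)) t| ≤ B₁) →
      ∀ t, ‖deriv (weilConv (fun t => ((w t : ℝ) : ℂ))
        (weilReflect fun t => ((weilThetaPhi t * (1 - θ t) : ℝ) : ℂ))) t‖ ≤ B₁ * ∫ s, w s) := by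
  have _ := hw
  have _ := hw0
  have _ := hθ01
  set vc : ℝ → ℂ := fun t => ((w t : ℝ) : ℂ) with hvc
  set κ : ℝ → ℂ := fun t : ℝ => ((weilThetaPhi t * (1 - θ t) : ℝ) : ℂ) with hκ
  -- the kernel lies in the strong class (prover A's envelope stub; `θ` has compact support)
  obtain ⟨hκd, hκb⟩ := stub_leakageKernelEnvelope θ hθ (ic_hasCompactSupport_cutoff hθ0)
  -- weighted-`L¹` data of `w` and the class data of `F`
  have hva : AEStronglyMeasurable vc volume := hwi.ofReal.aestronglyMeasurable
  have hvw := ic_integrable_norm_mul_exp hws hwi (1 : ℝ)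
  obtain ⟨hfcd, hfb, -⟩ := stub_strongClass_pairing vc κ 1 1 hva (by norm_num) hvw hκd
    (by norm_num) le_rfl hκb
  obtain ⟨Cf, hf0', hf1', hf2'⟩ := hExt_deriv_bounds_of_all hfb
  refine ⟨hfcd, ⟨Cf, hf0', hf1', hf2'⟩, fun t => ?_, fun B₁ hB₁ t => ?_⟩
  · -- the real form of the pairing
    rw [weilConv_leak_eq w θ t]
    congr 1
    refine integral_congr_ae (ae_of_all _ fun u => ?_)
    simp only [neg_sub]
  · -- `F' = w ⋆ κ̃'` and `‖κ̃'‖ ≤ B₁`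
    have hvi : Integrable vc := hwi.ofReal
    have hrc : ContDiff ℝ (⊤ : ℕ∞) (weilReflect κ) := scPair_contDiff_weilReflect hκd
    have hrb' : ∀ n : ℕ, ∃ B : ℝ, ∀ x, ‖iteratedDeriv n (weilReflect κ) x‖ ≤ B := by
      intro n
      obtain ⟨C, hC⟩ := hκb n
      refine ⟨max C 0, fun x => ?_⟩
      rw [scPair_norm_iteratedDeriv_weilReflect]
      refine (hC (-x)).trans ?_
      calc C * Real.exp (-(1 * |-x|)) ≤ max C 0 * Real.exp (-(1 * |-x|)) :=
            mul_le_mul_of_nonneg_right (le_max_left _ _) (Real.exp_pos _).le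
        _ ≤ max C 0 * 1 := mul_le_mul_of_nonneg_left
            (Real.exp_le_one_iff.2 (by nlinarith [abs_nonneg (-x)])) (le_max_right _ _)
        _ = max C 0 := mul_one _
    have hD : deriv (weilConv vc (weilReflect κ)) = weilConv vc (deriv (weilReflect κ)) := by
      have h := scPair_iteratedDeriv_eq hvi hrc hrb' 1
      simpa only [iteratedDeriv_one] using h
    have hκ'bd : ∀ y, ‖deriv (weilReflect κ) y‖ ≤ B₁ := by
      intro y
      have e1 : ‖deriv (weilReflect κ) y‖ = ‖deriv κ (-y)‖ := by
        rw [← iteratedDeriv_one, scPair_norm_iteratedDeriv_weilReflect, iteratedDeriv_one]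
      rw [e1, hκ, ic_deriv_kernel hθ, Complex.norm_real, Real.norm_eq_abs]
      exact hB₁ _
    rw [hD, weilConv_apply]
    calc ‖∫ u, vc u * deriv (weilReflect κ) (t - u)‖
        ≤ ∫ u, ‖vc u * deriv (weilReflect κ) (t - u)‖ := norm_integral_le_integral_norm _
      _ ≤ ∫ u, w u * B₁ := by
          refine integral_mono_of_nonneg (ae_of_all _ fun u => norm_nonneg _) (hwi.mul_const B₁)
            (ae_of_all _ fun u => ?_)
          dsimp only
          rw [norm_mul, hvc]
          dsimp only
          rw [Complex.norm_real, Real.norm_eq_abs, abs_of_nonneg (hw0 u)]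
          exact mul_le_mul_of_nonneg_left (hκ'bd _) (hw0 u)
      _ = B₁ * ∫ s, w s := by rw [integral_mul_const, mul_comm]

/-! ## Stub 4: the polar term of the collar pairing -/

/-- **Stub 4 of line `inner-cutoff-strong-EL` — the polar term of the collar pairing.**  For even
`θ`: `polar(w ⋆ κ̃) = ŵ(0) conj κ̂(1) + ŵ(1) conj κ̂(0) = (∫ κ cosh(t/2)) · (∫ w · 2cosh(t/2))`. -/
theorem stub_groundPolar {a : ℝ} {w θ : ℝ → ℝ} (hw : Measurable w) (hw0 : ∀ t, 0 ≤ w t)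
    (hws : ∀ t, t ∉ Ioo (-a) a → w t = 0) (hwi : Integrable w) (hθ : ContDiff ℝ (⊤ : ℕ∞) θ)
    (hθ0 : ∀ t, a ≤ |t| → θ t = 0) (hθ01 : ∀ t, 0 ≤ θ t ∧ θ t ≤ 1) (hθe : ∀ t, θ (-t) = θ t) :
    weilPolarTerm (weilConv (fun t => ((w t : ℝ) : ℂ))
      (weilReflect fun t => ((weilThetaPhi t * (1 - θ t) : ℝ) : ℂ))) =
    (((∫ t, weilThetaPhi t * (1 - θ t) * Real.cosh (t / 2)) * ∫ t, w t * (2 * Real.cosh (t / 2)) : ℝ) : ℂ) := by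
  have _ := hw
  have _ := hw0
  set vc : ℝ → ℂ := fun t => ((w t : ℝ) : ℂ) with hvc
  set κ : ℝ → ℂ := fun t : ℝ => ((weilThetaPhi t * (1 - θ t) : ℝ) : ℂ) with hκ
  set κr : ℝ → ℝ := fun t => weilThetaPhi t * (1 - θ t) with hκrdef
  obtain ⟨hκd, hκb⟩ := stub_leakageKernelEnvelope θ hθ (ic_hasCompactSupport_cutoff hθ0)
  have hκr : Continuous κr := continuous_leakKer hκd
  have hva : AEStronglyMeasurable vc volume := hwi.ofReal.aestronglyMeasurable
  have hvw := ic_integrable_norm_mul_exp hws hwi (1 : ℝ)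
  obtain ⟨-, -, hmel⟩ := stub_strongClass_pairing vc κ 1 1 hva (by norm_num) hvw hκd
    (by norm_num) le_rfl hκb
  -- the four real integrals
  have hM0 : weilMellin (weilConv vc (weilReflect κ)) 0 = weilMellin vc 0 * conj (weilMellin κ 1) := by
    have h := hmel 0 (by simp) (by simp)
    simpa using h
  have hM1 : weilMellin (weilConv vc (weilReflect κ)) 1 = weilMellin vc 1 * conj (weilMellin κ 0) := by
    have h := hmel 1 (by simp) (by simp)
    simpa using h
  have hv0M : weilMellin vc 0 = ((∫ t, w t * Real.exp (-(1 / 2) * t) : ℝ) : ℂ) :=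
    leakSign_weilMellin_ofReal w (by push_cast; ring)
  have hv1M : weilMellin vc 1 = ((∫ t, w t * Real.exp (1 / 2 * t) : ℝ) : ℂ) :=
    leakSign_weilMellin_ofReal w (by push_cast; ring)
  have hκ0M : weilMellin κ 0 = ((∫ t, κr t * Real.exp (-(1 / 2) * t) : ℝ) : ℂ) :=
    leakSign_weilMellin_ofReal κr (by push_cast; ring)
  have hκ1M : weilMellin κ 1 = ((∫ t, κr t * Real.exp (1 / 2 * t) : ℝ) : ℂ) :=
    leakSign_weilMellin_ofReal κr (by push_cast; ring)
  -- evenness of `κ`: `κ̂(0) = κ̂(1) = ∫ κ cosh(t/2)`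
  have hκre : ∀ t, κr (-t) = κr t := fun t => by
    simp only [hκrdef, weilThetaPhi_neg, hθe]
  have hint1 : Integrable fun t : ℝ => κr t * Real.exp (1 / 2 * t) :=
    leakSign_integrable_mul_exp_half hκr (leakKer_nonneg hθ01) (leakKer_le hθ01)
  have hint0 : Integrable fun t : ℝ => κr t * Real.exp (-(1 / 2) * t) := by
    have h := hint1.comp_neg
    refine h.congr (ae_of_all _ fun t => ?_)
    simp only [hκre]
    congr 1; ring_nf
  have hK01 : ∫ t, κr t * Real.exp (-(1 / 2) * t) = ∫ t, κr t * Real.exp (1 / 2 * t) := by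
    rw [← integral_neg_eq_self (fun t : ℝ => κr t * Real.exp (1 / 2 * t))]
    refine integral_congr_ae (ae_of_all _ fun t => ?_)
    simp only [hκre]
    congr 1; ring_nf
  have hKc : ∫ t, κr t * Real.exp (1 / 2 * t) = ∫ t, weilThetaPhi t * (1 - θ t) * Real.cosh (t / 2) := by
    have e : (fun t => weilThetaPhi t * (1 - θ t) * Real.cosh (t / 2)) =
        fun t => (1 / 2 : ℝ) * (κr t * Real.exp (1 / 2 * t)) + (1 / 2 : ℝ) * (κr t * Real.exp (-(1 / 2) * t)) := by
      funext t
      simp only [hκrdef, Real.cosh_eq]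
      have e1 : Real.exp (t / 2) = Real.exp (1 / 2 * t) := by congr 1; ring
      have e2 : Real.exp (-(t / 2)) = Real.exp (-(1 / 2) * t) := by congr 1; ring
      rw [e1, e2]; ring
    rw [e, integral_add (hint1.const_mul _) (hint0.const_mul _), integral_const_mul, integral_const_mul,
      hK01]
    ring
  -- `∫ w·2cosh(t/2) = ŵ(0) + ŵ(1)`
  have hvint : ∀ c : ℝ, Integrable fun t => w t * Real.exp (c * t) := by
    intro c
    refine ((ic_integrable_norm_mul_exp hws hwi |c|)).mono' (hwi.aestronglyMeasurable.mul (by fun_prop))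
      (ae_of_all _ fun t => ?_)
    rw [Real.norm_eq_abs, abs_mul, abs_of_pos (Real.exp_pos _)]
    rw [Complex.norm_real, Real.norm_eq_abs]
    refine mul_le_mul_of_nonneg_left (Real.exp_le_exp.2 ?_) (abs_nonneg _)
    calc c * t ≤ |c * t| := le_abs_self _
      _ = |c| * |t| := abs_mul c t
  have hsum : ∫ t, w t * (2 * Real.cosh (t / 2)) =
      (∫ t, w t * Real.exp (-(1 / 2) * t)) + ∫ t, w t * Real.exp (1 / 2 * t) := by
    rw [← integral_add (hvint _) (hvint _)]
    refine integral_congr_ae (ae_of_all _ fun t => ?_)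
    have e1 : Real.exp (-(1 / 2) * t) = Real.exp (-(t / 2)) := by congr 1; ring
    have e2 : Real.exp (1 / 2 * t) = Real.exp (t / 2) := by congr 1; ring
    simp only [e1, e2, Real.cosh_eq]
    ring
  rw [weilPolarTerm, hM0, hM1, hv0M, hv1M, hκ0M, hκ1M, Complex.conj_ofReal, Complex.conj_ofReal,
    hK01, hKc, hsum]
  push_cast
  ring

end Summit.RiemannHypothesis.RiemannHypothesis.Theorems.GroundBartaFloor

end
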